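import Summits.ResolutionOfSingularities.ResolutionOfSingularities.Theorems.EquisingularLiftEquisingularLiftNatOneStepVertexChart
import HarnessLib

/-!
# [OURS · L1 W4.5(b)] THE VERTEX CHART OF A ONE-STEP POINT OVER A DOMAIN BASE: `R[y₀,…,y_N]`, `R` a domain (e.g. `K[u]`, the surviving variables of a
# LINEAR centre), explicit strict transform and the Jacobian criterion (crux `Theses.EquisingularLift.EquisingularLiftNat`, stmt-ResolutionOfSingularities-20038)

NOT a statement of any manuscript; OURS kernel lemmas (cell `res-hironaka`, chain w45b; seat res-D-pv-013, own initiative, counted 0). AI-written,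
weaker than expert review. No definition, no `sorry`, standard axioms.

`OneStep.isRegularLocalRing_localization_blowupAlgebra` (p561125) treats the blow-up of a POINT of `𝔸ᴺ⁺¹_K`, `K` a field. For a LINEAR centre
`V(y) ⊂ Spec K[u, y]` the same algebra applies with the surviving variables `u` as COEFFICIENTS: `A = R[y₀,…,y_N]`, `R = K[u]` a domain, `I = (y)`. This file
ports the point-chart presentation to an arbitrary commutative (domain) base `R`:

* `OneStepRel.isQuasiRegular_X`, `isDomain_quotient_origin`, `mk_comp_C_injective` (`R → R[y]/(y)` is injective), `exists_algEquiv_pointChart`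
  (`R[T₀,…,T_N] ≃ₐ[R] A[I/y_a]`, `T_a ↦ y_a`, `T_j ↦ y_j/y_a`; the tree's `PointBlowup.polyEquiv` is over any ring), `algebraMap_eq_aeval_exc_mul_frac`,
  `algEquiv_aeval_subst`, `algEquiv_apply_eq_of_subst` (as in `OneStep`, over `R`);
* **`OneStepRel.isRegularLocalRing_localization_blowupAlgebra`** — `f = Φ + Ψ ∈ R[y]` with `Φ ≠ 0` homogeneous of degree `μ` in `y` (coefficients in
  `R`), `Ψ ∈ (y)^{μ+1}`, `G` with `f(T_a, T_aT_j) = T_a^μ·G`: if `R[T]/(G)` is regular at every prime containing `T̄_a` (in applications the Jacobian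
  criterion on `K[u, T]`), then the localisations of `(A/(f))[Ī/ȳ_a]` at the primes containing `ȳ_a` are regular. The route to one-step LINE centres
  (pinch points, the Whitney umbrella) of the any-`n` EL♮ supplier programme.

References: Görtz–Wedhorn I Prop. 13.96; The Stacks Project 0BIQ; Matsumura Thm. 14.2 — through the cited tree files.
-/

set_option linter.dupNamespace false -- mandated namespace `Summit.<Summit>.<Problem>` of this single-conjunct summit

noncomputable section

namespace Summit.ResolutionOfSingularities.ResolutionOfSingularities.Cruxes.EquisingularLiftNat.Sections

open MvPolynomial IsLocalization IsLocalRing Literature.AlgebraicGeometry.Resolution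

namespace OneStepRel

variable (R : Type) [CommRing R] {N : ℕ}

/-! ## The point chart over an arbitrary base ring -/

/-- The variables `(y₀, …, y_N)` form a quasi-regular sequence of `R[y₀,…,y_N]`, any commutative ring `R`. [folklore] -/
theorem isQuasiRegular_X : IsQuasiRegular (MvPolynomial.X : Fin (N + 1) → MvPolynomial (Fin (N + 1)) R) := by
  apply isQuasiRegular_of_isWeaklyRegular
  have h := MvPolynomial.isWeaklyRegular_map_X (R := R) (List.finRange (N + 1)) (List.nodup_finRange (N + 1))
  have hl : List.ofFn (MvPolynomial.X : Fin (N + 1) → MvPolynomial (Fin (N + 1)) R) =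
      (List.finRange (N + 1)).map (X : Fin (N + 1) → MvPolynomial (Fin (N + 1)) R) := by
    rw [List.ofFn_eq_map]
  rw [hl]
  exact h

/-- `R[y]/(y) ≅ R` is a domain for a domain `R`. [folklore] -/
theorem isDomain_quotient_origin [IsDomain R] :
    IsDomain (MvPolynomial (Fin (N + 1)) R ⧸ Ideal.span (Set.range (X : Fin (N + 1) → MvPolynomial (Fin (N + 1)) R))) := by
  rw [← Set.image_univ]
  exact MvPolynomial.isDomain_quotient_span_X Set.univ

/-- **`R → R[y]/(y)` is injective**: the constant coefficient is a retraction. [folklore] -/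
theorem mk_comp_C_injective : Function.Injective
    ((Ideal.Quotient.mk (Ideal.span (Set.range (X : Fin (N + 1) → MvPolynomial (Fin (N + 1)) R)))).comp (C : R →+* MvPolynomial (Fin (N + 1)) R)) := by
  classical
  have hI : ∀ a ∈ Ideal.span (Set.range (X : Fin (N + 1) → MvPolynomial (Fin (N + 1)) R)), constantCoeff a = 0 := by
    intro a ha
    have hle : Ideal.span (Set.range (X : Fin (N + 1) → MvPolynomial (Fin (N + 1)) R)) ≤ RingHom.ker (constantCoeff (R := R) (σ := Fin (N + 1))) := by
      rw [Ideal.span_le]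
      rintro _ ⟨i, rfl⟩
      simp
    exact hle ha
  intro r s hrs
  have h := congrArg (Ideal.Quotient.lift _ (constantCoeff (R := R) (σ := Fin (N + 1))) hI) hrs
  simpa using h

/-- **`R[T₀, …, T_N] ≃ₐ[R] A[𝔪/yᵢ]`, `Tᵢ ↦ yᵢ`, `T_j ↦ y_j/yᵢ` (`j ≠ i`)**, any commutative ring `R` — `PointBlowup.polyEquiv` reindexed through
`Fin (N + 1) ≃ Unit ⊕ {j // j ≠ i}` (port of `ConeN.exists_algEquiv_pointChart`). [folklore] -/
theorem exists_algEquiv_pointChart (i : Fin (N + 1)) :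
    ∃ θ : MvPolynomial (Fin (N + 1)) R ≃ₐ[R] PointBlowup.Chart N R i,
      θ (X i) = PointBlowup.exc N R i ∧ ∀ (j : Fin (N + 1)) (_ : j ≠ i), θ (X j) = PointBlowup.frac N R i j := by
  let e : Fin (N + 1) ≃ Unit ⊕ {j : Fin (N + 1) // j ≠ i} :=
    ((Equiv.optionSubtypeNe i).symm.trans (Equiv.optionEquivSumPUnit {j : Fin (N + 1) // j ≠ i})).trans (Equiv.sumComm _ _)
  have hei : e i = Sum.inl () := by simp [e]
  have hej : ∀ (j : Fin (N + 1)) (hj : j ≠ i), e j = Sum.inr ⟨j, hj⟩ := by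
    intro j hj
    simp [e, Equiv.optionSubtypeNe_symm_of_ne hj]
  have hC : ∀ c : R, PointBlowup.polyEquiv N R i (algebraMap R (MvPolynomial Unit (PointBlowup.Base N R i)) c) =
      algebraMap R (PointBlowup.Chart N R i) c := by
    intro c
    rw [IsScalarTower.algebraMap_apply R (PointBlowup.Base N R i) (MvPolynomial Unit (PointBlowup.Base N R i)),
      MvPolynomial.algebraMap_eq, MvPolynomial.algebraMap_eq, PointBlowup.polyEquiv_apply, PointBlowup.polyHom_C,
      PointBlowup.baseHom_C]
  let ρ : MvPolynomial Unit (PointBlowup.Base N R i) ≃ₐ[R] PointBlowup.Chart N R i :=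
    AlgEquiv.ofRingEquiv (f := PointBlowup.polyEquiv N R i) hC
  refine ⟨((renameEquiv R e).trans (sumAlgEquiv R Unit {j : Fin (N + 1) // j ≠ i})).trans ρ, ?_, ?_⟩
  · simp [ρ, hei]
  · intro j hj
    simp [ρ, hej j hj]

/-- The chart map `R[y] → A[𝔪/yᵢ]` is evaluation at `(yᵢ · (y_j/yᵢ))_j` (port of `ConeN.algebraMap_eq_aeval_exc_mul_frac`). [folklore] -/
theorem algebraMap_eq_aeval_exc_mul_frac (G : MvPolynomial (Fin (N + 1)) R) (i : Fin (N + 1)) :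
    algebraMap (MvPolynomial (Fin (N + 1)) R) (PointBlowup.Chart N R i) G =
      aeval (fun j => PointBlowup.exc N R i * PointBlowup.frac N R i j) G := by
  have h := congrArg (fun φ : MvPolynomial (Fin (N + 1)) R →ₐ[R] PointBlowup.Chart N R i => φ G)
    (MvPolynomial.algHom_ext (A := PointBlowup.Chart N R i)
      (f := IsScalarTower.toAlgHom R (MvPolynomial (Fin (N + 1)) R) (PointBlowup.Chart N R i))
      (g := aeval fun j => PointBlowup.exc N R i * PointBlowup.frac N R i j) fun j => by
        rw [IsScalarTower.toAlgHom_apply, aeval_X]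
        exact PointBlowup.algebraMap_X N R i j)
  simpa using h

/-- `θ(q(T_a, T_aT_j)) = q` in `A[𝔪/y_a]` (port of `OneStep.algEquiv_aeval_subst`). [folklore] -/
theorem algEquiv_aeval_subst (a : Fin (N + 1))
    (θ : MvPolynomial (Fin (N + 1)) R ≃ₐ[R] PointBlowup.Chart N R a) (hθa : θ (X a) = PointBlowup.exc N R a)
    (hθj : ∀ (j : Fin (N + 1)) (_ : j ≠ a), θ (X j) = PointBlowup.frac N R a j) (q : MvPolynomial (Fin (N + 1)) R) :
    θ (aeval (fun j => X a * Function.update (X : Fin (N + 1) → MvPolynomial (Fin (N + 1)) R) a 1 j) q) =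
      algebraMap (MvPolynomial (Fin (N + 1)) R) (PointBlowup.Chart N R a) q := by
  have hθupd : ∀ j : Fin (N + 1), θ (Function.update (X : Fin (N + 1) → MvPolynomial (Fin (N + 1)) R) a 1 j) = PointBlowup.frac N R a j := by
    intro j
    by_cases hj : j = a
    · subst hj
      rw [Function.update_self, map_one, PointBlowup.frac_self]
    · rw [Function.update_of_ne hj, hθj j hj]
  have h := MvPolynomial.algHom_ext (A := PointBlowup.Chart N R a)
    (f := (θ : MvPolynomial (Fin (N + 1)) R →ₐ[R] PointBlowup.Chart N R a).comp
      (aeval fun j => X a * Function.update (X : Fin (N + 1) → MvPolynomial (Fin (N + 1)) R) a 1 j))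
    (g := aeval fun j => PointBlowup.exc N R a * PointBlowup.frac N R a j) (fun j => by
      simp only [AlgHom.comp_apply, AlgEquiv.coe_toAlgHom, aeval_X, map_mul]
      rw [hθa, hθupd])
  have h' := DFunLike.congr_fun h q
  simp only [AlgHom.comp_apply, AlgEquiv.coe_toAlgHom] at h'
  rw [algebraMap_eq_aeval_exc_mul_frac R q a]
  exact h'

/-- `θ G = g` whenever `f(T_a, T_aT_j) = T_a^μ·G` and `f = t^μ·g` in `A[𝔪/y_a]` (port of `OneStep.algEquiv_apply_eq_of_subst`). [folklore] -/
theorem algEquiv_apply_eq_of_subst (a : Fin (N + 1))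
    (θ : MvPolynomial (Fin (N + 1)) R ≃ₐ[R] PointBlowup.Chart N R a) (hθa : θ (X a) = PointBlowup.exc N R a)
    (hθj : ∀ (j : Fin (N + 1)) (_ : j ≠ a), θ (X j) = PointBlowup.frac N R a j) {f G : MvPolynomial (Fin (N + 1)) R} {μ : ℕ}
    (hG : aeval (fun j => X a * Function.update (X : Fin (N + 1) → MvPolynomial (Fin (N + 1)) R) a 1 j) f = X a ^ μ * G)
    (g : PointBlowup.Chart N R a) (hg : algebraMap (MvPolynomial (Fin (N + 1)) R) (PointBlowup.Chart N R a) f = PointBlowup.exc N R a ^ μ * g) :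
    θ G = g := by
  have h1 := algEquiv_aeval_subst R a θ hθa hθj f
  rw [hG, map_mul, map_pow, hθa, hg] at h1
  have hsub : PointBlowup.exc N R a ^ μ * (θ G - g) = 0 := by
    rw [mul_sub, sub_eq_zero]
    exact h1
  rw [mul_left_mem_nonZeroDivisors_eq_zero_iff (pow_mem (PointBlowup.exc_mem_nonZeroDivisors N R a) μ), sub_eq_zero] at hsub
  exact hsub

/-! ## The vertex chart of a one-step point over a domain base -/

set_option maxHeartbeats 800000 in -- the chart algebra `blowupAlgebra` is a subalgebra of a localisation: slow instance unification (as in …NatOrdinaryPointVertexChart)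
/-- **THE VERTEX CHART OF A ONE-STEP POINT OVER A DOMAIN BASE, PRIME BY PRIME.** `A = R[y₀,…,y_N]` (`R` a domain), `I = (y)`, `f = Φ + Ψ` with `Φ ≠ 0`
homogeneous of degree `μ` in `y` (coefficients in `R`) and `Ψ ∈ I^{μ+1}`; `G ∈ R[T₀,…,T_N]` with `f(T_a, T_aT_j) = T_a^μ·G` (the explicit strict transform on the
`a`-th chart). Then `R[T]/(G) ≅ A[I/y_a]/(g₁) ≅ (A/(f))[Ī/ȳ_a]` (`T_a ↦ y_a`, `T_j ↦ y_j/y_a`; `g₁` the core's strict transform, `t^μ` cancelled), compatibly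
with `T_a ↦ ȳ_a`; hence if `R[T]/(G)` is a regular local ring at every prime containing `T̄_a` (in applications `R = K[u]` and this is the Jacobian
criterion on `K[u, T]`), then so is `(A/(f))[Ī/ȳ_a]` at every prime containing the exceptional equation `ȳ_a`. [cite: GortzWedhorn2020, Prop. 13.96]
[cite: StacksProject, Tag 0BIQ] -/
theorem isRegularLocalRing_localization_blowupAlgebra {N : ℕ} (R : Type) [CommRing R] [IsDomain R]
    (Φ Ψ : MvPolynomial (Fin (N + 1)) R) {μ : ℕ} (hΦ : Φ.IsHomogeneous μ) (hΦ0 : Φ ≠ 0)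
    (hΨ : Ψ ∈ Ideal.span (Set.range (X : Fin (N + 1) → MvPolynomial (Fin (N + 1)) R)) ^ (μ + 1)) (a : Fin (N + 1))
    (G : MvPolynomial (Fin (N + 1)) R)
    (hG : aeval (fun j => X a * Function.update (X : Fin (N + 1) → MvPolynomial (Fin (N + 1)) R) a 1 j) (Φ + Ψ) = X a ^ μ * G)
    (hregG : ∀ (P : Ideal (MvPolynomial (Fin (N + 1)) R ⧸ Ideal.span {G})) [P.IsPrime],
      Ideal.Quotient.mk (Ideal.span {G}) (X a) ∈ P → IsRegularLocalRing (Localization.AtPrime P))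
    (𝔑 : Ideal (blowupAlgebra ((Ideal.span (Set.range (X : Fin (N + 1) → MvPolynomial (Fin (N + 1)) R))).map
      (Ideal.Quotient.mk (Ideal.span {Φ + Ψ}))) (Ideal.Quotient.mk (Ideal.span {Φ + Ψ}) (X a)))) [𝔑.IsPrime]
    (h𝔑 : algebraMap (MvPolynomial (Fin (N + 1)) R ⧸ Ideal.span {Φ + Ψ}) _ (Ideal.Quotient.mk (Ideal.span {Φ + Ψ}) (X a)) ∈ 𝔑) :
    IsRegularLocalRing (Localization.AtPrime 𝔑) := by
  classical
  have hx : IsQuasiRegular (X : Fin (N + 1) → MvPolynomial (Fin (N + 1)) R) := isQuasiRegular_X R (N := N)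
  haveI hdom : IsDomain (MvPolynomial (Fin (N + 1)) R ⧸ Ideal.span (Set.range (X : Fin (N + 1) → MvPolynomial (Fin (N + 1)) R))) :=
    isDomain_quotient_origin R (N := N)
  -- the core's presentation `f = t^μ · g₁`, `g₁ = Φ(e) + tψ`
  have hΦ'h : (MvPolynomial.map (C : R →+* MvPolynomial (Fin (N + 1)) R) Φ).IsHomogeneous μ := hΦ.map _
  have heval : MvPolynomial.eval (X : Fin (N + 1) → MvPolynomial (Fin (N + 1)) R) (MvPolynomial.map (C : R →+* MvPolynomial (Fin (N + 1)) R) Φ) = Φ := by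
    rw [MvPolynomial.eval_map]
    exact MvPolynomial.eval₂_eta Φ
  obtain ⟨ψ, hcore⟩ := exists_algebraMap_tangentCone_eq (X : Fin (N + 1) → MvPolynomial (Fin (N + 1)) R) a hΦ'h hΨ
  rw [heval] at hcore
  have hΦbar : MvPolynomial.map (Ideal.Quotient.mk (Ideal.span (Set.range (X : Fin (N + 1) → MvPolynomial (Fin (N + 1)) R))))
      (dehomogenize a (MvPolynomial.map (C : R →+* MvPolynomial (Fin (N + 1)) R) Φ)) ≠ 0 := by
    rw [← map_dehomogenize, MvPolynomial.map_map]
    intro h0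
    apply dehomogenize_ne_zero_of_isHomogeneous a hΦ hΦ0
    exact (MvPolynomial.map_injective _ (mk_comp_C_injective R (N := N))) (h0.trans (map_zero _).symm)
  obtain ⟨ε, hε⟩ := exists_quotient_strictTransform_equiv_blowupAlgebra (X : Fin (N + 1) → MvPolynomial (Fin (N + 1)) R) a hx
    hΦbar ψ hcore
  -- `θ : R[T] ≅ A[I/y_a]` takes `G` to `g₁`
  obtain ⟨θ, hθa, hθj⟩ := exists_algEquiv_pointChart R (N := N) a
  have hθG := algEquiv_apply_eq_of_subst R a θ hθa hθj hG _ hcore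
  -- `R[T]/(G) ≅ A[I/y_a]/(g₁) ≅ (A/(f))[Ī/ȳ_a]`
  let η : (MvPolynomial (Fin (N + 1)) R ⧸ Ideal.span {G}) ≃+*
      (blowupAlgebra (Ideal.span (Set.range (X : Fin (N + 1) → MvPolynomial (Fin (N + 1)) R))) (X a) ⧸
        Ideal.span {MvPolynomial.aeval (blowupAlgebra.frac (X : Fin (N + 1) → MvPolynomial (Fin (N + 1)) R) a)
          (MvPolynomial.map (C : R →+* MvPolynomial (Fin (N + 1)) R) Φ) +
          algebraMap (MvPolynomial (Fin (N + 1)) R) (blowupAlgebra (Ideal.span (Set.range (X : Fin (N + 1) → MvPolynomial (Fin (N + 1)) R))) (X a))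
            (X a) * ψ}) :=
    Ideal.quotientEquiv _ _ θ.toRingEquiv (by
      rw [Ideal.map_span, Set.image_singleton]
      exact congrArg (fun b => Ideal.span {b}) hθG.symm)
  have he : ∀ q : MvPolynomial (Fin (N + 1)) R, ε (η (Ideal.Quotient.mk _ q)) =
      blowupAlgebra.mapQuotient (Ideal.span (Set.range (X : Fin (N + 1) → MvPolynomial (Fin (N + 1)) R))) (X a) (Ideal.span {Φ + Ψ}) (θ q) :=
    fun q => by rw [show η (Ideal.Quotient.mk _ q) = Ideal.Quotient.mk _ (θ q) from Ideal.quotientEquiv_mk _ _ _ _ q, hε]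
  -- the prime of `R[T]/(G)` under `𝔑` contains `T̄_a`
  obtain ⟨Pbar, hPbar⟩ : ∃ P : Ideal (MvPolynomial (Fin (N + 1)) R ⧸ Ideal.span {G}), P = 𝔑.comap ((η.trans ε).toRingHom) := ⟨_, rfl⟩
  haveI : Pbar.IsPrime := by rw [hPbar]; exact Ideal.comap_isPrime _ 𝔑
  have hmem : ∀ q, q ∈ Pbar ↔ ε (η q) ∈ 𝔑 := fun q => by rw [hPbar, Ideal.mem_comap]; rfl
  have haP : Ideal.Quotient.mk (Ideal.span {G}) (X a) ∈ Pbar := by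
    rw [hmem, he, hθa]
    have hexc : blowupAlgebra.mapQuotient (Ideal.span (Set.range (X : Fin (N + 1) → MvPolynomial (Fin (N + 1)) R))) (X a)
        (Ideal.span {Φ + Ψ}) (PointBlowup.exc N R a) =
        algebraMap (MvPolynomial (Fin (N + 1)) R ⧸ Ideal.span {Φ + Ψ}) _ (Ideal.Quotient.mk (Ideal.span {Φ + Ψ}) (X a)) :=
      blowupAlgebra.mapQuotient_algebraMap _ _ _ (X a)
    rw [hexc]
    exact h𝔑
  exact OrdPoint.isRegularLocalRing_localization_of_ringEquiv (η.trans ε) Pbar 𝔑 (fun q => (hmem q).symm) (hregG Pbar haP)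

end OneStepRel

end Summit.ResolutionOfSingularities.ResolutionOfSingularities.Cruxes.EquisingularLiftNat.Sections

end
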